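import Literature.Analysis.FluidPDE.SteadyNavierStokesProofs
import Literature.Analysis.FluidPDE.SteadyNavierStokesEnergy
import Literature.Analysis.FunctionSpaces.TorusFourierCalculus
import Literature.Analysis.FunctionSpaces.TorusSobolevNormFacts
import HarnessLib

/-!
# Route WindLine (AnomalousDissipation) — `WindySteadyLimit`: windy bookkeeping and the energy
equation of windy steady weak solutions

Helper file for stmt-AnomalousDissipation-11421 (`WindLine.WindySteadyLimit`). A *windy* field is
`u = c + U` with a constant momentum `c ∈ ℝ^d` and a mean-free part `U ∈ H`; this file supplies

* constants bookkeeping: Fourier coefficients and the spectral enstrophy of `c + U`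
  (`eGradNormSq_const_add`), derivatives of `w - c` for smooth `w`;
* the **energy equation of windy steady weak solutions** in dimension `2 ≤ d ≤ 4`
  (`windy_energy_eq`): if `U ∈ V`, `f ∈ L²` has zero mean and `u = c + U` solves the steady
  tested Navier–Stokes equations `∫ ⟪u,(u·∇)w⟫ + ν ⟪u,Δw⟫ + ⟪f,w⟫ = 0` against all smooth
  divergence-free mean-zero `w`, then `ν ‖∇u‖² = ∫ ⟪f, u⟫` — Temam's argument (Temam 1979,
  Ch. II §1, (1.21)–(1.22): test with `w = P_m U` and let `m → ∞`) with the two extra wind terms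
  `∫ ⟪(c·∇)P_m U, U⟫ = 0` (Fourier skew-symmetry of `c·∇`) and `∫ ⟪(U·∇)P_m U, c⟫ = 0` (weak
  incompressibility of `U`), the inertial term being handled by the tree's
  `tendsto_inertialPairing_fourierTruncate_of_card_le_four` (Temam's Lemma 1.2/1.3, `H¹ ⊂ L⁴`).

References: R. Temam, *Navier–Stokes Equations* (1979), Ch. II §1 Thm. 1.2, (1.21)–(1.22);
P. Constantin, C. Foias, *Navier–Stokes Equations* (1988), Ch. 8; G. P. Galdi, *An Introduction to
the Mathematical Theory of the Navier–Stokes Equations* (2011), Ch. IX (energy equality of steady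
solutions with nonzero flux/momentum).
-/

-- `Summit.<Summit>.<Problem>` is the tree's mandated summit-side namespace (CONVENTIONS §2); for this
-- single-conjunct summit the two coincide, so the duplicate is deliberate.
set_option linter.dupNamespace false

noncomputable section

open MeasureTheory Filter Topology UnitAddTorus Set
open scoped InnerProductSpace RealInnerProductSpace ENNReal NNReal

namespace Summit.AnomalousDissipation.AnomalousDissipation.Theorems.WindySteadyLimit

open Literature.Analysis.FunctionSpaces Literature.Analysis.FunctionSpaces.Torus
open Literature.Analysis.FluidPDE.Torus

variable {d : Type*} [Fintype d] [DecidableEq d]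

/-! ### Constants: Fourier coefficients and enstrophy -/

omit [DecidableEq d] in
/-- Fourier coefficients of a constant real vector field: `complexify c` at `k = 0`, zero otherwise.
[folklore] -/
theorem mFourierCoeff_complexify_const (c : EuclideanSpace ℝ d) (k : d → ℤ) :
    mFourierCoeff (EuclideanSpace.complexify ∘ fun _ : UnitAddTorus d => c) k =
      if k = 0 then EuclideanSpace.complexify c else 0 := by
  rw [show (EuclideanSpace.complexify ∘ fun _ : UnitAddTorus d => c) =
      fun _ => EuclideanSpace.complexify c from rfl,
    mFourierCoeff_eq_integral_volume, integral_smul_const, integral_mFourier]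
  by_cases hk : k = 0
  · subst hk; simp
  · simp [hk]

omit [DecidableEq d] in
/-- Fourier coefficients of a windy field `c + U`: those of `U`, plus `complexify c` at the zero
mode. [folklore] -/
theorem mFourierCoeff_complexify_const_add (c : EuclideanSpace ℝ d)
    {U : UnitAddTorus d → EuclideanSpace ℝ d} (hU : Integrable U volume) (k : d → ℤ) :
    mFourierCoeff (EuclideanSpace.complexify ∘ fun x => c + U x) k =
      (if k = 0 then EuclideanSpace.complexify c else 0) +
        mFourierCoeff (EuclideanSpace.complexify ∘ U) k := by
  have h : (EuclideanSpace.complexify ∘ fun x => c + U x) =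
      (EuclideanSpace.complexify ∘ fun _ : UnitAddTorus d => c) + EuclideanSpace.complexify ∘ U := by
    funext x; simp
  rw [h, mFourierCoeff_add (integrable_complexify_comp (integrable_const c))
    (integrable_complexify_comp hU), mFourierCoeff_complexify_const]

omit [DecidableEq d] in
/-- **The wind carries no enstrophy**: `‖∇(c + U)‖² = ‖∇U‖²` (the spectral enstrophy ignores the
zero mode, the only one a constant changes). [folklore] -/
theorem eGradNormSq_const_add (c : EuclideanSpace ℝ d) {U : UnitAddTorus d → EuclideanSpace ℝ d}
    (hU : Integrable U volume) : eGradNormSq (fun x => c + U x) = eGradNormSq U := by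
  rw [eGradNormSq_eq_tsum, eGradNormSq_eq_tsum]
  congr 1
  refine tsum_congr fun k => ?_
  rw [mFourierCoeff_complexify_const_add c hU]
  by_cases hk : k = 0
  · subst hk; simp [freqNormSq]
  · rw [if_neg hk, zero_add]

omit [Fintype d] [DecidableEq d] in
/-- `∫ ⟪g, c⟫ = ⟪∫ g, c⟫` for an integrable field and a constant vector. [folklore] -/
theorem integral_inner_const_right {α : Type*} [MeasurableSpace α] {μ : Measure α}
    {E : Type*} [NormedAddCommGroup E] [InnerProductSpace ℝ E] [CompleteSpace E]
    {g : α → E} (hg : Integrable g μ) (c : E) :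
    ∫ x, ⟪g x, c⟫_ℝ ∂μ = ⟪∫ x, g x ∂μ, c⟫_ℝ := by
  calc ∫ x, ⟪g x, c⟫_ℝ ∂μ = ∫ x, ⟪c, g x⟫_ℝ ∂μ :=
        integral_congr_ae (ae_of_all _ fun x => real_inner_comm _ _)
    _ = ⟪c, ∫ x, g x ∂μ⟫_ℝ := integral_inner hg c
    _ = ⟪∫ x, g x ∂μ, c⟫_ℝ := real_inner_comm _ _

/-! ### Smooth fields minus constants -/

omit [DecidableEq d] in
/-- The torus derivative of a constant field vanishes. [folklore] -/
theorem torusFDeriv_const (c : EuclideanSpace ℝ d) (x : UnitAddTorus d) :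
    Torus.fderiv (fun _ : UnitAddTorus d => c) x = 0 := by
  have hl : liftAt (fun _ : UnitAddTorus d => c) x = fun _ => c := rfl
  rw [Torus.fderiv, hl]
  exact fderiv_const_apply c

/-- The convective derivative does not see constants in the convected field:
`(u·∇)(w - c) = (u·∇)w`. [folklore] -/
theorem convect_sub_const {w : UnitAddTorus d → EuclideanSpace ℝ d} (hw : IsSmooth w)
    (c : EuclideanSpace ℝ d) (u : UnitAddTorus d → EuclideanSpace ℝ d) (x : UnitAddTorus d) :
    Torus.convect u (fun y => w y - c) x = Torus.convect u w x := by
  rw [convect_sub_apply hw (isSmooth_const c) u x]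
  simp [Torus.convect, torusFDeriv_const]

/-- The Laplacian does not see constants: `Δ(w - c) = Δw`. [folklore] -/
theorem laplacian_sub_const {w : UnitAddTorus d → EuclideanSpace ℝ d} (hw : IsSmooth w)
    (c : EuclideanSpace ℝ d) (x : UnitAddTorus d) :
    Torus.laplacian (fun y => w y - c) x = Torus.laplacian w x := by
  rw [laplacian_sub_apply hw (isSmooth_const c) x]
  have h0 : Torus.laplacian (fun _ : UnitAddTorus d => c) x = 0 := by
    rw [laplacian_eq_sum_partialDeriv_partialDeriv (isSmooth_const c)]
    refine Finset.sum_eq_zero fun i _ => ?_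
    have h2 : (partialDeriv i fun _ : UnitAddTorus d => c) = fun _ => 0 := by
      funext y
      simp [partialDeriv, Torus.lineDeriv]
    rw [h2]
    simp [partialDeriv, Torus.lineDeriv]
  rw [h0, sub_zero]

/-- A smooth divergence-free field minus a constant is divergence free. [folklore] -/
theorem isDivFree_sub_const {u : UnitAddTorus d → EuclideanSpace ℝ d} (hu : IsSmooth u)
    (hdiv : IsDivFree u) (c : EuclideanSpace ℝ d) : IsDivFree (fun y => u y - c) := by
  intro x
  have h : ∀ i, partialDeriv i (fun y => (u y - c) i) x = partialDeriv i (fun y => u y i) x := by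
    intro i
    have h1 : (fun y => (u y - c) i) = fun y => u y i - c i := by
      funext y; simp
    rw [h1]
    exact (((hu.apply i).hasDerivAt_line_zero i x).sub_const (c i)).deriv
  unfold divergence
  simp_rw [h]
  exact hdiv x

omit [DecidableEq d] in
/-- A field minus its mean has zero mean (`T^d` has unit volume). [folklore] -/
theorem hasZeroMean_sub_integral {F : Type*} [NormedAddCommGroup F] [NormedSpace ℝ F]
    [CompleteSpace F] {u : UnitAddTorus d → F} (hu : Integrable u volume) :
    HasZeroMean (fun y => u y - ∫ x, u x) := by
  unfold HasZeroMean
  rw [integral_sub hu (integrable_const _), integral_const]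
  simp

omit [DecidableEq d] in
/-- The zero Fourier mode of a real field is its (complexified) mean. [folklore] -/
theorem mFourierCoeff_complexify_zero (u : UnitAddTorus d → EuclideanSpace ℝ d) :
    mFourierCoeff (EuclideanSpace.complexify ∘ u) 0 = EuclideanSpace.complexify (∫ x, u x) := by
  rw [mFourierCoeff_eq_integral_volume]
  simp only [neg_zero, mFourier_zero, ContinuousMap.one_apply, one_smul, Function.comp_apply]
  exact EuclideanSpace.complexify.integral_comp_comm u


/-! ### The three wind terms of the inertial pairing -/

/-- **A constant transports nothing**: `∫ ⟪Dw(x) a, c⟫ dx = 0` for smooth `w` and constant vectors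
`a`, `c` (`∫ ∂ⱼ w = 0` on the torus). [folklore] -/
theorem integral_inner_fderiv_const_const {w : UnitAddTorus d → EuclideanSpace ℝ d}
    (hw : IsSmooth w) (a c : EuclideanSpace ℝ d) :
    ∫ x, ⟪Torus.fderiv w x a, c⟫_ℝ = 0 := by
  have h1 : ∀ x, Torus.fderiv w x a = ∑ i, a i • partialDeriv i w x := fun x =>
    fderiv_apply_eq_sum_partialDeriv (hw.isContDiff (by simp)) x a
  simp_rw [h1, sum_inner, real_inner_smul_left]
  rw [integral_finsetSum _ fun i _ =>
    (((hw.partialDeriv i).continuous.inner continuous_const).integrable_unitAddTorus).const_mul _]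
  refine Finset.sum_eq_zero fun i _ => ?_
  rw [integral_const_mul, integral_inner_const_right (hw.partialDeriv i).integrable,
    integral_partialDeriv_eq_zero_holds hw i, inner_zero_left, mul_zero]

/-- `⟪Dw(x) v, c⟫ = ⟪v, ∇⟪c, w⟫(x)⟫` for smooth `w` (the adjoint of `Dw(x)` on a constant is the
gradient of the component `⟪c, w⟫`). [folklore] -/
theorem inner_fderiv_apply_const {w : UnitAddTorus d → EuclideanSpace ℝ d} (hw : IsSmooth w)
    (x : UnitAddTorus d) (v c : EuclideanSpace ℝ d) :
    ⟪Torus.fderiv w x v, c⟫_ℝ = ⟪v, Torus.gradient (fun y => ⟪c, w y⟫_ℝ) x⟫_ℝ := by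
  have hθs : IsSmooth (fun y => ⟪c, w y⟫_ℝ) := (isSmooth_const c).inner hw
  rw [real_inner_comm (Torus.gradient _ x) v, Torus.inner_gradient_left,
    fderiv_apply_eq_sum_partialDeriv (hθs.isContDiff (by simp)),
    fderiv_apply_eq_sum_partialDeriv (hw.isContDiff (by simp)), sum_inner]
  refine Finset.sum_congr rfl fun i _ => ?_
  rw [real_inner_smul_left, smul_eq_mul]
  congr 1
  have h := partialDeriv_clm_comp hw (innerSL ℝ c) i x
  have hfun : (⇑(innerSL ℝ c) ∘ w) = fun y => ⟪c, w y⟫_ℝ := by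
    funext y; simp
  rw [hfun, innerSL_apply_apply] at h
  rw [h, real_inner_comm]

/-- **The wake does no work on the wind**: `∫ ⟪Dw(x) U(x), c⟫ dx = 0` for a weakly
divergence-free `U`, smooth `w` and a constant `c` (test the weak incompressibility of `U` with the
scalar `⟪c, w⟫`). [folklore] -/
theorem integral_inner_fderiv_apply_const_eq_zero {U : UnitAddTorus d → EuclideanSpace ℝ d}
    (hU : IsWeaklyDivFree U) {w : UnitAddTorus d → EuclideanSpace ℝ d} (hw : IsSmooth w)
    (c : EuclideanSpace ℝ d) : ∫ x, ⟪Torus.fderiv w x (U x), c⟫_ℝ = 0 := by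
  simp_rw [inner_fderiv_apply_const hw]
  exact hU _ ((isSmooth_const c).inner hw)

/-- **The wind drift is skew**: `∫ ⟪(c·∇)P_m U, U⟫ = 0` for `U ∈ L²` and a constant `c`
(Parseval: `∑_{|k|≤m} Re (2πi kⱼ) ‖Û(k)‖² = 0` coordinatewise). [folklore] -/
theorem integral_inner_fderiv_fourierTruncate_const_eq_zero
    {U : UnitAddTorus d → EuclideanSpace ℝ d} (hU : MemLp U 2 volume) (c : EuclideanSpace ℝ d)
    (m : ℕ) : ∫ x, ⟪Torus.fderiv (fourierTruncate m U) x c, U x⟫_ℝ = 0 := by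
  have hw : IsSmooth (fourierTruncate m U) := isSmooth_fourierTruncate m U
  have hint : Integrable U volume := hU.integrable one_le_two
  have h1 : ∀ x, ⟪Torus.fderiv (fourierTruncate m U) x c, U x⟫_ℝ =
      ∑ i, c i * ⟪U x, partialDeriv i (fourierTruncate m U) x⟫_ℝ := fun x => by
    rw [fderiv_apply_eq_sum_partialDeriv (hw.isContDiff (by simp)) x c, sum_inner]
    refine Finset.sum_congr rfl fun i _ => ?_
    rw [real_inner_smul_left, real_inner_comm]
  simp_rw [h1]
  rw [integral_finsetSum _ fun i _ =>
    (integrable_inner_of_continuous hint (hw.partialDeriv i).continuous).const_mul _]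
  refine Finset.sum_eq_zero fun i _ => ?_
  rw [integral_const_mul]
  have hS := neg_mem_freqBall_of_mem (d := d) (N := m)
  have hcs := (isConjSymm_mFourierCoeff hint).deriv i
  simp_rw [fourierTruncate_eq, partialDeriv_realTrigPoly]
  rw [integral_inner_realTrigPoly_right hS hcs hU, Finset.sum_eq_zero fun k _ => ?_, mul_zero]
  rw [inner_smul_right, inner_self_eq_norm_sq_to_K]
  simp [Complex.mul_re, Complex.mul_im, pow_two]

/-! ### The energy equation of windy steady weak solutions -/

/-- **Energy equation of windy steady weak solutions on `T^d`, `2 ≤ d ≤ 4`** (Temam 1979, Ch. II §1,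
(1.21)–(1.22), run with a free momentum; Galdi 2011, Ch. IX). Let `f ∈ L²` have zero mean,
`c ∈ ℝ^d`, `U ∈ V`, and suppose `u = c + U` solves the steady tested Navier–Stokes equations
`∫ ⟪u,(u·∇)w⟫ + ν ⟪u,Δw⟫ + ⟪f,w⟫ = 0` for every smooth divergence-free mean-zero `w`. Then
`ν ‖∇u‖² = ∫ ⟪f, u⟫`. Proof: test with `w = P_m U`; the Stokes term is `-ν ‖∇P_m U‖² → -ν ‖∇U‖²`
(`∫ ΔP_m U = 0` kills the wind), the forcing term tends to `(f, U) = (f, u)` (`∫ f = 0`), and of the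
four inertial terms `∫ ⟪DP_mU·c, c⟫ = 0`, `∫ ⟪DP_mU·c, U⟫ = 0` (skew drift), `∫ ⟪DP_mU·U, c⟫ = 0`
(weak incompressibility) and `∫ ⟪DP_mU·U, U⟫ → 0` (Temam's Lemma 1.2/1.3 through `H¹ ⊂ L⁴`,
`tendsto_inertialPairing_fourierTruncate_of_card_le_four`). [cite: Temam1979, Ch. II Thm. 1.2, (1.21)–(1.22)] -/
theorem windy_energy_eq (hd2 : 2 ≤ Fintype.card d) (hd4 : Fintype.card d ≤ 4) {ν : ℝ}
    {f : UnitAddTorus d → EuclideanSpace ℝ d} (hf : MemLp f 2 volume) (hf0 : ∫ x, f x = 0)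
    (c : EuclideanSpace ℝ d) (U : energySpace d)
    (hV : MemSobolev 1 (EuclideanSpace.complexify ∘
      ((U.1 : Lp (EuclideanSpace ℝ d) 2 (volume : Measure (UnitAddTorus d))) :
        UnitAddTorus d → EuclideanSpace ℝ d)))
    (hweak : ∀ w : UnitAddTorus d → EuclideanSpace ℝ d, IsSmooth w → IsDivFree w → HasZeroMean w →
      ∫ x, (⟪c + (U.1 : UnitAddTorus d → EuclideanSpace ℝ d) x,
          Torus.convect (fun y => c + (U.1 : UnitAddTorus d → EuclideanSpace ℝ d) y) w x⟫_ℝ +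
        ν * ⟪c + (U.1 : UnitAddTorus d → EuclideanSpace ℝ d) x, Torus.laplacian w x⟫_ℝ +
        ⟪f x, w x⟫_ℝ) = 0) :
    ν * (eGradNormSq fun x => c + (U.1 : UnitAddTorus d → EuclideanSpace ℝ d) x).toReal =
      ∫ x, ⟪f x, c + (U.1 : UnitAddTorus d → EuclideanSpace ℝ d) x⟫_ℝ := by
  set Uf : UnitAddTorus d → EuclideanSpace ℝ d := (U.1 : UnitAddTorus d → EuclideanSpace ℝ d)
    with hUf
  have hUH : U.1 ∈ energySpace d := U.2
  have hmem : MemLp Uf 2 volume := Lp.memLp _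
  have hint : Integrable Uf volume := hmem.integrable one_le_two
  have hwdf : IsWeaklyDivFree Uf := isWeaklyDivFree_of_mem_energySpace hUH
  have hfin : eGradNormSq Uf ≠ ⊤ := hV.eGradNormSq_lt_top.ne
  have hum : MemLp (fun x => c + Uf x) 2 volume := (memLp_const c).add hmem
  -- the truncations `P_m U` are admissible test fields
  have hWs : ∀ m, IsSmooth (fourierTruncate m Uf) := fun m => isSmooth_fourierTruncate m Uf
  have hWdiv : ∀ m, IsDivFree (fourierTruncate m Uf) := fun m => isDivFree_fourierTruncate hmem hwdf m
  have hWmean : ∀ m, HasZeroMean (fourierTruncate m Uf) := fun m =>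
    hasZeroMean_fourierTruncate_of_mem hUH m
  -- the tested identity, split into forcing, Stokes and inertial terms
  have hgal : ∀ m, (∫ x, ⟪f x, fourierTruncate m Uf x⟫_ℝ) +
      ν * (∫ x, ⟪c + Uf x, Torus.laplacian (fourierTruncate m Uf) x⟫_ℝ) +
      ∫ x, ⟪Torus.fderiv (fourierTruncate m Uf) x (c + Uf x), c + Uf x⟫_ℝ = 0 := fun m => by
    rw [← integral_weakForm_eq ν hf hum (hWs m)]
    exact hweak _ (hWs m) (hWdiv m) (hWmean m)
  -- Stokes term: `∫ ⟪c + U, Δ P_m U⟫ = -‖∇P_m U‖²`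
  have hlap : ∀ m, ∫ x, ⟪c + Uf x, Torus.laplacian (fourierTruncate m Uf) x⟫_ℝ =
      -(eGradNormSq (fourierTruncate m Uf)).toReal := by
    intro m
    simp_rw [inner_add_left]
    rw [integral_add (integrable_inner_of_continuous (integrable_const c) (hWs m).laplacian.continuous)
        (integrable_inner_of_continuous hint (hWs m).laplacian.continuous),
      integral_inner_laplacian_fourierTruncate hint m, integral_inner (hWs m).laplacian.integrable c]
    have h0 : ∫ x, Torus.laplacian (fourierTruncate m Uf) x = 0 := by
      simp_rw [laplacian_eq_sum_partialDeriv_partialDeriv (hWs m)]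
      rw [integral_finsetSum _ fun i _ => (((hWs m).partialDeriv i).partialDeriv i).integrable]
      exact Finset.sum_eq_zero fun i _ =>
        integral_partialDeriv_eq_zero_holds ((hWs m).partialDeriv i) i
    rw [h0, inner_zero_right, zero_add]
  -- inertial term: only `∫ (U ⊗ U) : ∇P_m U` survives
  have hinert : ∀ m, ∫ x, ⟪Torus.fderiv (fourierTruncate m Uf) x (c + Uf x), c + Uf x⟫_ℝ =
      inertialPairing U.1 (fourierTruncate m Uf) := by
    intro m
    have hWc : Continuous fun x => Torus.fderiv (fourierTruncate m Uf) x :=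
      continuous_fderiv_of_isSmooth (hWs m)
    simp_rw [map_add, inner_add_left, inner_add_right]
    have i1 : Integrable (fun x => ⟪Torus.fderiv (fourierTruncate m Uf) x c, c⟫_ℝ) volume :=
      ((hWc.clm_apply continuous_const).inner continuous_const).integrable_unitAddTorus
    have i2 : Integrable (fun x => ⟪Torus.fderiv (fourierTruncate m Uf) x c, Uf x⟫_ℝ) volume :=
      (integrable_inner_of_continuous hint (hWc.clm_apply continuous_const)).congr
        (ae_of_all _ fun x => real_inner_comm _ _)
    have i3 : Integrable (fun x => ⟪Torus.fderiv (fourierTruncate m Uf) x (Uf x), c⟫_ℝ) volume := by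
      simp_rw [inner_fderiv_apply_const (hWs m)]
      exact integrable_inner_of_continuous hint ((isSmooth_const c).inner (hWs m)).gradient.continuous
    have i4 : Integrable (fun x => ⟪Torus.fderiv (fourierTruncate m Uf) x (Uf x), Uf x⟫_ℝ) volume :=
      (integrable_inner_convect_of_memLp hmem (hWs m)).congr
        (ae_of_all _ fun x => real_inner_comm _ _)
    have i12 : Integrable (fun x => ⟪Torus.fderiv (fourierTruncate m Uf) x c, c⟫_ℝ +
        ⟪Torus.fderiv (fourierTruncate m Uf) x c, Uf x⟫_ℝ) volume := i1.add i2
    have i34 : Integrable (fun x => ⟪Torus.fderiv (fourierTruncate m Uf) x (Uf x), c⟫_ℝ +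
        ⟪Torus.fderiv (fourierTruncate m Uf) x (Uf x), Uf x⟫_ℝ) volume := i3.add i4
    rw [integral_add i12 i34, integral_add i1 i2, integral_add i3 i4,
      integral_inner_fderiv_const_const (hWs m) c c,
      integral_inner_fderiv_fourierTruncate_const_eq_zero hmem c m,
      integral_inner_fderiv_apply_const_eq_zero hwdf (hWs m) c]
    simp [inertialPairing, hUf]
  -- the three limits
  have h1 : Tendsto (fun m => ∫ x, ⟪f x, fourierTruncate m Uf x⟫_ℝ) atTop
      (𝓝 (∫ x, ⟪f x, Uf x⟫_ℝ)) := tendsto_integral_inner_fourierTruncate hf hmem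
  have h2 : Tendsto (fun m => (eGradNormSq (fourierTruncate m Uf)).toReal) atTop
      (𝓝 (eGradNormSq Uf).toReal) := tendsto_toReal_eGradNormSq_fourierTruncate hint hfin
  have h3 : Tendsto (fun m => inertialPairing U.1 (fourierTruncate m Uf)) atTop (𝓝 0) :=
    tendsto_inertialPairing_fourierTruncate_of_card_le_four hd2 hd4 hUH hV
  have hlim : Tendsto (fun m => (∫ x, ⟪f x, fourierTruncate m Uf x⟫_ℝ) +
      ν * (-(eGradNormSq (fourierTruncate m Uf)).toReal) +
      inertialPairing U.1 (fourierTruncate m Uf)) atTop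
      (𝓝 ((∫ x, ⟪f x, Uf x⟫_ℝ) + ν * (-(eGradNormSq Uf).toReal) + 0)) :=
    (h1.add (h2.neg.const_mul ν)).add h3
  have hzero : ∀ m, (∫ x, ⟪f x, fourierTruncate m Uf x⟫_ℝ) +
      ν * (-(eGradNormSq (fourierTruncate m Uf)).toReal) +
      inertialPairing U.1 (fourierTruncate m Uf) = 0 := fun m => by
    rw [← hlap m, ← hinert m]
    exact hgal m
  have heq := tendsto_nhds_unique hlim (tendsto_const_nhds.congr fun m => (hzero m).symm)
  -- `(f, c + U) = (f, U)` since `∫ f = 0`, and `‖∇(c + U)‖ = ‖∇U‖`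
  have hfU : Integrable (fun x => ⟪f x, Uf x⟫_ℝ) volume :=
    (L2.integrable_inner (𝕜 := ℝ) (hf.toLp f) U.1).congr (by
      filter_upwards [hf.coeFn_toLp] with x hx
      rw [hx])
  have hfu : ∫ x, ⟪f x, c + Uf x⟫_ℝ = ∫ x, ⟪f x, Uf x⟫_ℝ := by
    simp_rw [inner_add_right]
    rw [integral_add (integrable_inner_of_continuous (hf.integrable one_le_two) continuous_const)
        hfU, integral_inner_const_right (hf.integrable one_le_two) c, hf0, inner_zero_left,
      zero_add]
  rw [hfu, eGradNormSq_const_add c hint]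
  linarith

end Summit.AnomalousDissipation.AnomalousDissipation.Theorems.WindySteadyLimit

end
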